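import Literature.MathematicalPhysics.QuantumFieldTheory.Balaban1983to89.B7Prop4LinCovIterClosed
import Literature.MathematicalPhysics.QuantumFieldTheory.Balaban1983to89.B7Prop5GeneralLevels
import Literature.MathematicalPhysics.QuantumFieldTheory.Balaban1983to89.B9Eq332FieldAvgCovariance
import Literature.MathematicalPhysics.QuantumFieldTheory.Balaban1983to89.B7Eq136SecondOrderSkewAdjoint

/-!
# `Balaban1983to89.B7Prop4LinCovIterClosedLaws` — T. Bałaban, *Averaging operations for lattice gauge theories*, Commun. Math. Phys. **98** (1985)
# 17–51 [Balaban1985Averaging] p. 24 (after (43)), p. 31 (after (91)), (11) p. 19, (22)–(23) p. 21, (122) p. 36, p. 38; T. Bałaban, *Propagators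
# for lattice gauge theories in a background field*, Commun. Math. Phys. **99** (1985) 389–434 [Balaban1985BackgroundPropagators] (3.14)–(3.15) p. 393,
# (3.28)–(3.32) pp. 395–396, p. 391 («hermitian matrices»): THE THREE STRUCTURAL LAWS OF THE GATED LINEAR AVERAGING `linQcovC ∕ linCovIterC` —
# LOCALITY in the box `B^j(c₋) ∪ B^j(c₊)` (every background), GAUGE COVARIANCE `Q_j(U^u)R(u)A = R(u_j)Q_j(U)A` (every background, `u` with
# `|u|, |u⁻¹| ≤ 1`), REALITY `(Q_j(U)B)⋆ = −Q_j(U)B` for skew `B` (on [5] Prop. 2's class)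

statement-level skeleton of published theorems with citation tags; proofs where landed; nothing here is a claim about the
Yang–Mills mass gap

PDFs held: `paper:balaban1985-cmp98-averaging`, `paper:balaban1985-cmp99-background-propagators`; read through the verbatim quotations of
`B7Prop1Local`, `B7Prop5GeneralLevels`, `B9Eq332FieldAvgCovariance`, `B7Eq136SecondOrderSkewAdjoint`.

CITATION HEADER (lean-in-tree rule).  Cell `pub-ymgap`, seat `pub-ymgap-dag-n06-l` (gen 35; K1⁹ `stmt-QuantumFields-27364` SUPPORTS lane), programme P-Q15 file 3:
the laws (L2) locality, (L5) covariance, (L4) reality of node00-def-Y's `R2-REPIN-DESIGN.md` §3 for the averaging letter of print, at the `ℤ^{d+1}` level (the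
def-Y-carrier forms are the sequel).  REUSED BY NAME, nothing restated: file 1 (`LoopDisc ∕ linQcovC ∕ linCovIterC ∕ linCovIterC_eq_linCovIter_of_prop2`);
b07's locality (`B7Prop1Local.AgreeOn ∕ Wcx_congr ∕ avgIter_congr ∕ bondHi ∕ loK ∕ bondHiK`, `B7Prop5Flat.inBox_nest`, `B7Prop5GeneralLevels.linQcov_congr`);
the covariance files (`B7Prop1Explicit.gaugeAct ∕ Wcx_gaugeAct ∕ norm_units_conj_sub_one_le`, `B7AvgGaugeCovariance.uLev`, `B7Prop6Flat.avgIter_gaugeAct_units`,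
`B9Eq332FieldAvgCovariance.linQcov_rot`); this seat's g34 reality file (`B7Eq136SecondOrderSkewAdjoint.star_linCovIter_eq_neg`).

THE PRINT.  [5] p. 24: *«this definition is local in the sense that Ū^k_c, c ⊂ Ω^{(k)}, depends only on the bond variables U_b for b ⊂ B^k(c₋) ∪ B^k(c₊)»*;
p. 31: *«the same locality properties»*; [B9] p. 395–396, (3.32): *«Inspecting the definitions of averaging operators Q_j(U) for gauge fields we can see that the
equalities (3.32) hold again»* (`Q_j(U^u)R(u) = R(u)Q_j(U)`); p. 391: the fields take values in *«N × N hermitian matrices»* (the lineage's skew reading,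
DICTIONARY (D1) of `Node00.OpsYSectDReal`).

WHAT IS PROVED (sorry-free; theorems only, no `def`, no `Prop` placeholder; no estimate of the papers).
* §1 LOCALITY (every background): `loopDisc_congr` (the gate reads only the bonds of `B(c₋) ∪ B(c₊)`), ★ `linQcovC_congr`, ★★ `linCovIterC_congr` (`(LʲηQ_j(U₀)B)(c)`
  depends only on `U₀` and `B` on the bonds of `B^j(c₋) ∪ B^j(c₊)` — the twin of r06's `B9Ineq3137LocalSup.linCovIter_congr`, now unconditional in `U₀`).
* §2 COVARIANCE (every background, gauge functions with `u(x) ∈ {|u| ≤ 1, |u⁻¹| ≤ 1}` — e.g. unitary): `loopDisc_gaugeAct_iff` (the gate is gauge invariant: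
  the block loops conjugate by `u(c₋)`, `‖uWu⁻¹ − 1‖ = ‖W − 1‖`), ★ `linQcovC_rot` (`Q(V₀^u)R(u)A = R(u(c₋))Q(V₀)A`), ★★ `linCovIterC_rot` ((3.32) for the gated
  composite: `LʲηQ_j(U₀^u)R(u)B = R(u_j)LʲηQ_j(U₀)B`, `u_j(z) = u(Lʲz)` — keyed at the block CORNER).
* §3 REALITY (on [5] Prop. 2's class over `G ≤ U(𝔸)`): ★ `star_linCovIterC_eq_neg` (`(LʲηQ_j(U₀)B)⋆ = −LʲηQ_j(U₀)B` for skew bounded `B`, `j ≤ k`, under g34's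
  displayed smallness of `α₀` and of `‖B‖`; from `star_linCovIter_eq_neg` by file 1's agreement on the class).

HONEST SCOPE.  Bookkeeping over landed locality ∕ covariance ∕ reality theorems; the gate makes §1–§2 unconditional in the background (off the disc both
sides are `0`); §3 is a statement on the class only (off it the letter is `0`, trivially skew — not recorded).  Count-neutral; NOT summit progress; nothing
continuum ∕ ℝ⁴ ∕ OS ∕ mass gap ∕ Clay — the Yang–Mills mass gap is NOT proved here.  NEW file; nothing landed is modified.  No `sorry`, no `axiom`, no
`instance`, no `notation`.  Net new unproved facts: 0.
-/

noncomputable section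

open scoped BigOperators
open NormedSpace Finset

namespace Literature.MathematicalPhysics.QuantumFieldTheory.Balaban1983to89.B7Prop4LinCovIterClosedLaws

open B7Prop1Explicit B7Prop1Local B7Prop2Explicit B7Prop3Flat B7Eq92Concrete MatrixLog B7Prop3GeneralRotated B7Prop3GeneralLinear
  B7Prop3GeneralTild B7Prop4GeneralLevels B7AvgGaugeCovariance
open B7Eq78Linearization (conjR conjR_apply conjR_add conjR_sub conjR_smul conjR_one)
open B7Prop5Flat (BondIn inBox_nest)
open B7Prop5GeneralLevels (linQcov_congr)
open B7Prop6Flat (avgIter_gaugeAct_units)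
open B9Eq332FieldAvgCovariance (linQcov_rot)
open B7Prop4LinCovIterClosed (LoopDisc linQcovC linQcovC_eq_linQcov linQcovC_of_not_loopDisc linCovIterC linCovIterC_zero linCovIterC_succ
  linCovIterC_eq_linCovIter_of_prop2)
open B7Eq136SecondOrderSkewAdjoint (star_linCovIter_eq_neg)

-- `Site` alone would resolve to the torus sites of `Setup.lean`; re-export the `ℤ^d` sites of `B7Prop1Explicit`.
export B7Prop1Explicit (Site)

variable {d : ℕ}

/-! ## §1 Locality: the gated letter reads only the bonds of `B^j(c₋) ∪ B^j(c₊)` -/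

section Locality

variable {𝔸 : Type*} [NormedRing 𝔸] [NormedAlgebra ℂ 𝔸] [CompleteSpace 𝔸]
variable (L : ℕ)

omit [NormedAlgebra ℂ 𝔸] [CompleteSpace 𝔸] in
/-- [folklore] the bond's end-points and the block sites `c₋ + r`, `c₊ + r` lie in the box `[c₋, bondHi]` of `B(c₋) ∪ B(c₊)`. -/
private theorem loops_congr (hL : 1 ≤ L) {V V' : Site d → Fin d → 𝔸ˣ} (q : Site d) (κ : Fin d)
    (h : AgreeOn q (bondHi L q κ) V V') (r : Fin d → Fin L) : Wcx L V q κ (boxVec L r) = Wcx L V' q κ (boxVec L r) := by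
  have hq : InBox q (bondHi L q κ) q := fun i => by
    simp only [bondHi]; split_ifs <;> omega
  have hqL : InBox q (bondHi L q κ) (q + (L : ℤ) • e κ) := fun i => by
    simp only [bondHi, add_zsmul_e_apply]; split_ifs <;> omega
  have hr : ∀ i, 0 ≤ boxVec L r i ∧ boxVec L r i + 1 ≤ L := fun i =>
    ⟨by simp [boxVec], by have := (r i).isLt; simp only [boxVec]; omega⟩
  refine Wcx_congr L h q κ _ hq (fun i => ?_) (fun i => ?_) hqL
  · have := hr i; simp only [bondHi, Pi.add_apply]; split_ifs <;> omega
  · have := hr i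
    simp only [bondHi, Pi.add_apply, Pi.smul_apply, smul_eq_mul, e_apply, mul_ite, mul_one, mul_zero]
    split_ifs <;> omega

omit [NormedAlgebra ℂ 𝔸] [CompleteSpace 𝔸] in
/-- **THE GATE IS LOCAL**: whether the block loops of `c` lie in the disc of (21) depends only on the bonds of `B(c₋) ∪ B(c₊)` (`Wcx_congr`).
[cite: Balaban1985Averaging, p.24 (after (43)), (42) p.23] -/
theorem loopDisc_congr (hL : 1 ≤ L) {V V' : Site d → Fin d → 𝔸ˣ} (q : Site d) (κ : Fin d) (h : AgreeOn q (bondHi L q κ) V V') :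
    LoopDisc L V q κ ↔ LoopDisc L V' q κ := by
  unfold LoopDisc
  simp only [loops_congr L hL q κ h]

/-- ★ **LOCALITY OF THE GATED ONE-STEP LETTER**: `linQcovC L V₀ A c` depends only on `V₀` and `A` on the bonds of `B(c₋) ∪ B(c₊)` — at EVERY background
(the gate by `loopDisc_congr`, the linear part by `B7Prop5GeneralLevels.linQcov_congr`). [cite: Balaban1985Averaging, p.24 (after (43)), p.31 (after (91)), (122) p.36] -/
theorem linQcovC_congr (hL : 1 ≤ L) (q : Site d) (κ : Fin d) {V₀ V₀' : Site d → Fin d → 𝔸ˣ} {A A' : Site d → Fin d → 𝔸}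
    (h₀ : AgreeOn q (bondHi L q κ) V₀ V₀') (hA : AgreeOn q (bondHi L q κ) A A') :
    linQcovC L V₀ A q κ = linQcovC L V₀' A' q κ := by
  by_cases hW : LoopDisc L V₀ q κ
  · have hW' : LoopDisc L V₀' q κ := (loopDisc_congr L hL q κ h₀).1 hW
    rw [linQcovC_eq_linQcov L V₀ A q κ hW, linQcovC_eq_linQcov L V₀' A' q κ hW', linQcov_congr L hL q κ h₀ hA]
  · have hW' : ¬ LoopDisc L V₀' q κ := fun h' => hW ((loopDisc_congr L hL q κ h₀).2 h')
    rw [linQcovC_of_not_loopDisc L V₀ A q κ hW, linQcovC_of_not_loopDisc L V₀' A' q κ hW']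

/-- ★★ **LOCALITY OF THE GATED COMPOSITE** — p. 24∕p. 31 for «LʲηQ_j(U₀)»: `linCovIterC L U₀ B j (z, κ)` depends only on the bond variables of `U₀` AND of
`B` in `B^j(c₋) ∪ B^j(c₊) = [Lʲz, Lʲz + (Lʲ − 1)𝟙 + Lʲe_κ]`, at EVERY background (r06's `linCovIter_congr` verbatim with the gated one-step locality).
[cite: Balaban1985Averaging, p.38 (before (133)), (122) p.36, p.24 (after (43)), p.31 (after (91))] -/
theorem linCovIterC_congr (hL : 1 ≤ L) :
    ∀ (j : ℕ) {U₀ U₀' : Site d → Fin d → 𝔸ˣ} {B B' : Site d → Fin d → 𝔸} (z : Site d) (κ : Fin d),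
      AgreeOn (loK L j z) (bondHiK L j z κ) U₀ U₀' → AgreeOn (loK L j z) (bondHiK L j z κ) B B' →
        linCovIterC L U₀ B j z κ = linCovIterC L U₀' B' j z κ
  | 0, U₀, U₀', B, B', z, κ, _, h => by
    refine h z κ (fun i => ?_) (fun i => ?_)
    · simp only [loK, bondHiK, pow_zero, one_mul]; split_ifs <;> omega
    · simp only [loK, bondHiK, pow_zero, one_mul, add_e_apply]; split_ifs <;> omega
  | j + 1, U₀, U₀', B, B', z, κ, h₀, h => by
    rw [linCovIterC_succ, linCovIterC_succ]
    refine linQcovC_congr L hL _ κ (fun x μ hx hxe => ?_) (fun x μ hx hxe => ?_)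
    · exact avgIter_congr L hL j x μ fun p ν hp hpν =>
        h₀ p ν (inBox_nest L j z κ ⟨hx, hxe⟩ hp) (inBox_nest L j z κ ⟨hx, hxe⟩ hpν)
    · exact linCovIterC_congr hL j x μ
        (fun p ν hp hpν => h₀ p ν (inBox_nest L j z κ ⟨hx, hxe⟩ hp) (inBox_nest L j z κ ⟨hx, hxe⟩ hpν))
        (fun p ν hp hpν => h p ν (inBox_nest L j z κ ⟨hx, hxe⟩ hp) (inBox_nest L j z κ ⟨hx, hxe⟩ hpν))

end Locality

/-! ## §2 Gauge covariance (3.32): `Q_j(U^u)R(u) = R(u_j)Q_j(U)`, keyed at the block corner -/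

section Covariance

variable {𝔸 : Type*} [NormedRing 𝔸] [NormedAlgebra ℂ 𝔸] [NormOneClass 𝔸] [CompleteSpace 𝔸]
variable (L : ℕ)

omit [NormedAlgebra ℂ 𝔸] [CompleteSpace 𝔸] in
/-- **THE GATE IS GAUGE INVARIANT**: the block loops of `V₀^u` are those of `V₀` conjugated by `u(c₋)` (`Wcx_gaugeAct`), and conjugation by a unit with
`|u|, |u⁻¹| ≤ 1` preserves `‖W − 1‖` (`norm_units_conj_sub_one_le` both ways). [cite: Balaban1985Averaging, (45) p.24, (11) p.19] -/
theorem loopDisc_gaugeAct_iff (u : Site d → 𝔸ˣ) (V₀ : Site d → Fin d → 𝔸ˣ) (q : Site d) (κ : Fin d) (hu : u q ∈ U1 𝔸) :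
    LoopDisc L (gaugeAct u V₀) q κ ↔ LoopDisc L V₀ q κ := by
  unfold LoopDisc
  refine forall_congr' fun r => ?_
  rw [Wcx_gaugeAct, Units.val_mul, Units.val_mul]
  constructor
  · intro h
    have h' := norm_units_inv_conj_sub_one_le hu ((u q : 𝔸) * (Wcx L V₀ q κ (boxVec L r) : 𝔸) * ((u q)⁻¹ : 𝔸ˣ))
    have he : (((u q)⁻¹ : 𝔸ˣ) : 𝔸) * ((u q : 𝔸) * (Wcx L V₀ q κ (boxVec L r) : 𝔸) * ((u q)⁻¹ : 𝔸ˣ)) * (u q : 𝔸)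
        = (Wcx L V₀ q κ (boxVec L r) : 𝔸) := by
      rw [← mul_assoc, ← mul_assoc, Units.inv_mul, one_mul, mul_assoc, Units.inv_mul, mul_one]
    rw [he] at h'
    exact lt_of_le_of_lt h' h
  · intro h
    exact lt_of_le_of_lt (norm_units_conj_sub_one_le hu _) h

/-- ★ **(3.32) FOR THE GATED ONE-STEP LETTER**: `Q(V₀^u)(R(u)A)_c = R(u(c₋))(Q(V₀)A)_c` at every background, for `u(c₋) ∈ {|u| ≤ 1, |u⁻¹| ≤ 1}` (the
linear part by `B9Eq332FieldAvgCovariance.linQcov_rot`, the gate by `loopDisc_gaugeAct_iff`). [cite: Balaban1985BackgroundPropagators, (3.32) pp.395–396; Balaban1985Averaging, (11) p.19, (122) p.36] -/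
theorem linQcovC_rot (u : Site d → 𝔸ˣ) (V₀ : Site d → Fin d → 𝔸ˣ) (A : Site d → Fin d → 𝔸) (q : Site d) (κ : Fin d)
    (hu : u q ∈ U1 𝔸) :
    linQcovC L (gaugeAct u V₀) (fun x κ => conjR (u x) (A x κ)) q κ = conjR (u q) (linQcovC L V₀ A q κ) := by
  by_cases hW : LoopDisc L V₀ q κ
  · rw [linQcovC_eq_linQcov L _ _ q κ ((loopDisc_gaugeAct_iff L u V₀ q κ hu).2 hW), linQcovC_eq_linQcov L V₀ A q κ hW]
    exact linQcov_rot L u V₀ A q κ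
  · rw [linQcovC_of_not_loopDisc L _ _ q κ (fun h => hW ((loopDisc_gaugeAct_iff L u V₀ q κ hu).1 h)),
      linQcovC_of_not_loopDisc L V₀ A q κ hW]
    simp [conjR_apply]

/-- ★★ **(3.32) FOR THE GATED COMPOSITE** — «the equalities (3.32) hold again»: `LʲηQ_j(U₀^u)(R(u)B)(z, κ) = R(u_j(z))(LʲηQ_j(U₀)B)(z, κ)` with
`u_j(z) = u(Lʲz)` (the gauge function read at the block CORNER), at EVERY background, for `u` with values in `{|u| ≤ 1, |u⁻¹| ≤ 1}` (e.g. unitary); from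
`linQcovC_rot` at every level and the covariance (11) of the tower `\overline{(U^u)}^l = (Ū^l)^{u_l}` (`avgIter_gaugeAct_units`).
[cite: Balaban1985BackgroundPropagators, (3.32) pp.395–396, (3.14)–(3.15) p.393; Balaban1985Averaging, p.38, (11) p.19] -/
theorem linCovIterC_rot (u : Site d → 𝔸ˣ) (hu : ∀ x, u x ∈ U1 𝔸) (U₀ : Site d → Fin d → 𝔸ˣ) (B : Site d → Fin d → 𝔸) :
    ∀ (j : ℕ) (z : Site d) (κ : Fin d),
      linCovIterC L (gaugeAct u U₀) (fun x κ => conjR (u x) (B x κ)) j z κ = conjR (uLev L u j z) (linCovIterC L U₀ B j z κ)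
  | 0, z, κ => by rw [linCovIterC_zero, linCovIterC_zero, uLev_zero]
  | j + 1, z, κ => by
    have ih : linCovIterC L (gaugeAct u U₀) (fun x κ => conjR (u x) (B x κ)) j
        = fun x κ => conjR (uLev L u j x) (linCovIterC L U₀ B j x κ) :=
      funext fun x => funext fun κ => linCovIterC_rot u hu U₀ B j x κ
    rw [linCovIterC_succ, linCovIterC_succ, avgIter_gaugeAct_units L u U₀ j, ih,
      linQcovC_rot L (uLev L u j) _ _ _ κ (by rw [uLev_apply]; exact hu _), uLev_smul]

end Covariance

/-! ## §3 Reality on [5] Proposition 2's class: the composite takes `𝔤` to `𝔤` -/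

section Reality

variable {𝔸 : Type*} [CStarAlgebra 𝔸] [Nontrivial 𝔸]

/-- ★ **`(LʲηQ_j(U₀)B)⋆ = −LʲηQ_j(U₀)B` FOR SKEW `B`, FOR THE GATED COMPOSITE**, every `j ≤ k`, on [5] Prop. 2's class over a unitary-valued averaging-closed
`G` (the hypotheses of g34's `B7Eq136SecondOrderSkewAdjoint.star_linCovIter_eq_neg` verbatim: `4α₀ ≤ c₂′`, the displayed smallness of `α₀` and of the bound
`b` of `B`); there the gated composite IS `linCovIter` (file 1). [cite: Balaban1985BackgroundPropagators, p.391 («hermitian matrices»); Balaban1985Averaging, (127) p.37, (22)–(23) p.21] -/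
theorem star_linCovIterC_eq_neg (L : ℕ) (hL : 2 ≤ L) {G : Subgroup 𝔸ˣ} (hG : AvgClosed d L G) (hGU : G ≤ unitaryUnits 𝔸) (k : ℕ)
    (U₀ : Site d → Fin d → 𝔸ˣ) (hU₀ : ∀ x κ, U₀ x κ ∈ G) {α₀ : ℝ} (hα : 0 < α₀)
    (hα3 : C0 d * α₀ ≤ 1 / 3) (hα4 : 4 * α₀ ≤ c2' d L) (h52 : pdev U₀ < α₀ * (((L : ℝ) ^ k)⁻¹) ^ 2)
    (B : Site d → Fin d → 𝔸) {b : ℝ} (hb : 0 ≤ b) (hB : ∀ x κ, ‖B x κ‖ ≤ b) (hBs : ∀ x κ, star (B x κ) = -B x κ)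
    (hsmall : Real.exp (4 * (800 * ((d : ℝ) + 1) ^ 2 * ((d : ℝ) + 4)) * α₀)
      * (1 + 8 * (131072 * ((d : ℝ) + 1) ^ 2) * ((L : ℝ) ^ k * b)) ≤ 2)
    (hc₃ : 2 * ((L : ℝ) ^ k * b) ≤ c3 d L) :
    ∀ j ≤ k, ∀ (z : Site d) (κ : Fin d), star (linCovIterC L U₀ B j z κ) = -linCovIterC L U₀ B j z κ := by
  intro j hj z κ
  have hα2 : 2 * α₀ ≤ c2' d L := by linarith
  rw [linCovIterC_eq_linCovIter_of_prop2 L U₀ hL hG k hU₀ hα hα3 hα2 h52 B j hj]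
  exact star_linCovIter_eq_neg L hL hG hGU k U₀ hU₀ hα hα3 hα4 h52 B hb hB hBs hsmall hc₃ j hj z κ

end Reality

end Literature.MathematicalPhysics.QuantumFieldTheory.Balaban1983to89.B7Prop4LinCovIterClosedLaws

end
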